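import Literature.Barriers.ValiantsHypothesis.NotViaSaturationsChowProofs
import Literature.Computability.AlgebraicComplexity.ChowHighestWeight
import HarnessLib

/-!
# Not via saturations — BHI Theorem 3 (and hence Theorem 1) proved

Bürgisser–Hüttenhain–Ikenmeyer, *Permanent versus determinant: not via saturations*, Proc. AMS 145
(2017) = arXiv:1501.05528. `NotViaSaturationsChow.lean` reduced Theorem 1 (`BHI2017_thm1`, the
barrier `NotViaSaturations`) to Theorem 3 (`BHI2017_thm3`: "`Sat(S(Chow_n)) = {λ ∈ Λ⁺(poly) |
|λ| ≡ 0 mod n}` provided `n > 2`") and `NotViaSaturationsChowProofs.lean` reduced Prop. 3 (the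
group generated by `S(Chow_n)`) to the existence of suitable generators
(`closure_chowOccWeights_eq_bhiLattice_of_generators`).

This file PROVES Theorem 3 (`BHI2017_thm3_holds`), hence Prop. 3 (`BHI2017_prop3_holds`), Theorem 1
(`BHI2017_thm1_holds`) and the barrier (`NotViaSaturations_holds`), from the algebra of the Chow
variety developed in `Literature/Computability/AlgebraicComplexity/Chow*.lean`:

* **Bridge** (`mem_closure_chowOccWeights_of_isRealized`, `nsmul_mem_chowOccWeights_of_isRealized`):
  a weight `ψ` realised by a nonzero symmetric balanced highest-weight vector `F ∈ 𝒪(V^m // H_m)_δ`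
  (`IsRealized ℂ m δ ψ`, i.e. `ψ^* ∈ S(V^m // H_m)` in the language of BHI Lemma 4) has
  `ψ^* ∈ A(S(Chow_m))` and `t·ψ^* ∈ S(Chow_m)` for some `t > 0`: by BRION'S THEOREM
  (`exists_symBalanced_subset_range`: `𝒪(V^m // H_m)_n = 𝒪(Chow_m)_n` for `n ≫ 0`) the products
  `F · π^s` and the powers `F^t` lie in `𝒪(Chow_m) = im(φ_m^*)` for `s, t ≫ 0`, and pull back to
  nonzero highest-weight vectors on the orbit closure `Chow_m`
  (`hasHighestWeight_orbitCoordRep_prod_X_of_mem_range`); `π` has weight `(m) ∈ S(Chow_m)`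
  (`single_zero_mem_chowOccWeights`). This is the printed "Proposition 1 tells us that `A` equals
  the group generated by the monoid `S(V^n // H_n)`" and "`S(Chow_n)` and `S(V^n // H_n)` generate
  the same rational cone", for the Chow variety, with Prop. 1's non-rigorous minimal-polynomial
  argument replaced by Brion's finite-cokernel theorem.
* **Prop. 3** (`chow_generators`, `BHI2017_prop3_holds`): the generators `λ^{(2)} = (n-1,1) =
  (3n-3,3) - (2n-2,2)` and `λ^{(k)}`, `3 ≤ k ≤ n`, are realised by the explicit symmetrised
  products of minors of `ChowHighestWeight.lean` (`isRealized_gen3`, `isRealized_genK`).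
* **The cone** (`exists_nsmul_mem_chowOccWeights`): every polynomial weight `χ` has a positive
  multiple in `S(Chow_m)` (`isRealized_conePsi`: `2m·χ` is realised by products of the cone
  generators) — the half of Prop. 2 used for Theorem 3 (the bound `N < n^{n²-2n}` is not needed).
* **Theorem 3** (`BHI2017_thm3_holds`) as in `BHI2017_thm3_of_props`; **Theorem 1** and the
  barrier by `BHI2017_thm1_of_thm3`, `notViaSaturations_of_thm3`; **Prop. 2** (the cone assertion,
  named fact `BHI2017_prop2`) by `BHI2017_prop2_holds`.

## References

* [BurgisserHuttenhainIkenmeyer2017] §2 Prop. 1; §3 Lemmas 3–6, Props. 2–3, Thm. 3; §1 Thm. 1.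
* M. Brion, Manuscripta Math. 80 (1993) 347–371 (finiteness and the cokernel of `ψ_n^*`).
-/

noncomputable section

open MvPolynomial

namespace Literature.Barriers.ValiantsHypothesis

open Literature.NumberTheory.DiophantineGeometry Literature.Computability.AlgebraicComplexity
  Literature.Computability.Complexity

variable {m : ℕ}

/-! ### The bridge: realised weights of `𝒪(V^m // H_m)` and `S(Chow_m)` -/

/-- The last-row product `π = ∏_j x_j` lies in `𝒪(V^m // H_m)_1`. [folklore] -/
theorem rowProd_mem_symBalanced_one (i₀ : Fin m) :
    (∏ j : Fin m, (X (i₀, j) : MvPolynomial (Fin m × Fin m) ℂ)) ∈ symBalanced (k := ℂ) m 1 := by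
  rw [← chowPullback_X_rowDegIdx]
  exact chowPullback_X_mem_symBalanced_one m _

/-- The last-row product is the product of the `1 × 1` last-rows minors `x_j`, hence a
highest-weight vector of weight `m · (-𝟙_{m-1})`. [folklore] -/
theorem rowProd_mem_highestWeightSpace (hm : 0 < m) :
    (∏ j : Fin m, (X (⟨m - 1, by omega⟩, j) : MvPolynomial (Fin m × Fin m) ℂ)) ∈
      highestWeightSpace (formsRep m) (m • lastWeight m 1) := by
  have h1 : (1 : ℕ) ≤ m := hm
  have hX : ∀ j : Fin m, (X (⟨m - 1, by omega⟩, j) : MvPolynomial (Fin m × Fin m) ℂ) =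
      lastX ℂ m h1 j := fun j => by
    rw [lastX, lastMinor, Matrix.det_unique]
    simp [lastMatrix, Literature.Computability.AlgebraicComplexity.lastIdx, Fin.default_eq_zero]
  have h := prod_mem_highestWeightSpace_formsRep (k := ℂ) Finset.univ
    (fun j : Fin m => lastX ℂ m h1 j) (fun _ => lastWeight m 1)
    fun j _ => lastMinor_mem_highestWeightSpace m h1 _
  rw [Finset.sum_const, Finset.card_univ, Fintype.card_fin] at h
  simp_rw [← hX] at h
  exact h

/-- The dual of `m · (-𝟙_{m-1})` is `(m, 0, …, 0) = m ε_0`. [folklore] -/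
theorem dual_nsmul_lastWeight_one (hm : 0 < m) :
    (m • lastWeight m 1).dual = (Pi.single (⟨0, hm⟩ : Fin m) (m : ℤ) : Weight (Fin m)) := by
  rw [Weight.dual_nsmul, dual_lastWeight m hm]
  funext i
  simp only [Pi.smul_apply, fundWeight_apply, nsmul_eq_mul, Pi.single_apply, Fin.ext_iff,
    Nat.lt_one_iff]
  split_ifs <;> simp

/-- **BHI Prop. 1, group part, for the Chow variety — proved.** A weight realised by a nonzero
symmetric balanced highest-weight vector of `𝒪(V^m // H_m)` (an element of `S(V^m // H_m)`,
Lemma 4) has its dual in `A(S(Chow_m))`: multiply the vector by `π^s` into the range of Brion's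
theorem, lift to `Chow_m`, and subtract `s · (m) ∈ S(Chow_m)`. In print: "Proposition 1 tells us
that `A` equals the group generated by the monoid `S(V^n // H_n)`."
[cite: BurgisserHuttenhainIkenmeyer2017, Prop. 1 and §3 (before Lemma 5)] -/
theorem mem_closure_chowOccWeights_of_isRealized (hm : 0 < m) {δ : ℕ} {ψ : Weight (Fin m)}
    (h : IsRealized ℂ m δ ψ) :
    ψ.dual ∈ AddSubgroup.closure (chowOccWeights m : Set (Weight (Fin m))) := by
  classical
  obtain ⟨F, hF0, hF, hFw⟩ := h
  obtain ⟨D, hD⟩ := exists_symBalanced_subset_range (k := ℂ) m (⟨0, hm⟩ : Fin m)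
  set π : MvPolynomial (Fin m × Fin m) ℂ := ∏ j : Fin m, X (⟨m - 1, by omega⟩, j) with hπ
  have hπ0 : π ≠ 0 := Finset.prod_ne_zero_iff.mpr fun j _ => X_ne_zero _
  have hG : F * π ^ D ∈ symBalanced (k := ℂ) m (δ + D * 1) :=
    mul_mem_symBalanced m hF (pow_mem_symBalanced m (rowProd_mem_symBalanced_one _) D)
  rw [mul_one] at hG
  have hGr : F * π ^ D ∈ (chowPullback (k := ℂ) m).range := hD (δ + D) (by omega) _ hG
  have hGw : F * π ^ D ∈ highestWeightSpace (formsRep m) (ψ + D • (m • lastWeight m 1)) :=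
    mul_mem_highestWeightSpace_formsRep hFw
      (pow_mem_highestWeightSpace_formsRep (rowProd_mem_highestWeightSpace hm) D)
  have hocc := hasHighestWeight_orbitCoordRep_prod_X_of_mem_range m hGw hGr
    (mul_ne_zero hF0 (pow_ne_zero _ hπ0))
  have hmem : ψ.dual + D • (Pi.single (⟨0, hm⟩ : Fin m) (m : ℤ) : Weight (Fin m)) ∈
      chowOccWeights m := by
    rw [mem_chowOccWeights_iff, Weight.dual_add, Weight.dual_dual, Weight.dual_nsmul,
      ← dual_nsmul_lastWeight_one hm, Weight.dual_dual]
    exact hocc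
  have hsub := AddSubgroup.sub_mem _ (AddSubgroup.subset_closure hmem)
    (AddSubgroup.nsmul_mem _ (single_zero_mem_closure_chowOccWeights hm) D)
  rwa [add_sub_cancel_right] at hsub

/-- **BHI Prop. 1, cone part, for the Chow variety — proved.** A weight realised in a positive
degree has a positive multiple of its dual in `S(Chow_m)` (powers of the vector land in the range of
Brion's theorem). In print: "the semigroups `S(Chow_n)` and `S(V^n // H_n)` generate the same
rational cone." [cite: BurgisserHuttenhainIkenmeyer2017, Prop. 1 and §3 (proof of Prop. 2)] -/
theorem nsmul_mem_chowOccWeights_of_isRealized (hm : 0 < m) {δ : ℕ} {ψ : Weight (Fin m)}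
    (h : IsRealized ℂ m δ ψ) (hδ : 0 < δ) : ∃ t : ℕ, 0 < t ∧ t • ψ.dual ∈ chowOccWeights m := by
  obtain ⟨F, hF0, hF, hFw⟩ := h
  obtain ⟨D, hD⟩ := exists_symBalanced_subset_range (k := ℂ) m (⟨0, hm⟩ : Fin m)
  refine ⟨D + 1, Nat.succ_pos _, ?_⟩
  have hG : F ^ (D + 1) ∈ symBalanced (k := ℂ) m ((D + 1) * δ) := pow_mem_symBalanced m hF _
  have hGr : F ^ (D + 1) ∈ (chowPullback (k := ℂ) m).range :=
    hD _ (le_trans (Nat.le_succ D) (Nat.le_mul_of_pos_right _ hδ)) _ hG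
  have hGw := pow_mem_highestWeightSpace_formsRep hFw (D + 1)
  have hocc := hasHighestWeight_orbitCoordRep_prod_X_of_mem_range m hGw hGr (pow_ne_zero _ hF0)
  rw [mem_chowOccWeights_iff, Weight.dual_nsmul, Weight.dual_dual]
  exact hocc

/-! ### Prop. 3: the generators -/

/-- **The generators of BHI Prop. 3, realised**: for `m > 2` and `1 ≤ k < m` (0-based) there is
`w ∈ A(S(Chow_m))` with `w_k = 1` and `w_i = 0` for `i > k` — for `k = 1` the difference
`(3m-3,3) - (2m-2,2) = (m-1,1)` of the duals of `psi3` and `psiK 2`, for `k ≥ 2` the dual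
`λ^{(k+1)}` of `psiK (k+1)` ("`λ^{(2)} := (n-1,1,0,…,0) = (3n-3,3,0,…,0) - (2n-2,2,0,…,0)` lies in
the group `A`", "`λ^{(k)}_k = 1` and `λ^{(k)}_i = 0` for `i > k`").
[cite: BurgisserHuttenhainIkenmeyer2017, Prop. 3 (proof)] -/
theorem chow_generators (hm : 2 < m) (k : Fin m) (hk : 0 < (k : ℕ)) :
    ∃ w ∈ AddSubgroup.closure (chowOccWeights m : Set (Weight (Fin m))),
      w k = 1 ∧ ∀ i : Fin m, k < i → w i = 0 := by
  have hm0 : 0 < m := by omega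
  by_cases hk1 : (k : ℕ) = 1
  · refine ⟨(psi3 m).dual - (psiK m 2).dual, AddSubgroup.sub_mem _
      (mem_closure_chowOccWeights_of_isRealized hm0 (isRealized_gen3 ℂ m (by omega)))
      (mem_closure_chowOccWeights_of_isRealized hm0 (isRealized_genK ℂ m le_rfl (by omega))),
      ?_, ?_⟩
    · rw [Pi.sub_apply, dual_psi3_apply m (by omega) k (by omega),
        dual_psiK_two_apply m (by omega) k (by omega), if_pos hk1, if_pos hk1]
      norm_num
    · intro i hi
      have hi1 : 1 < (i : ℕ) := by have := Fin.lt_def.mp hi; omega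
      rw [Pi.sub_apply, dual_psi3_apply m (by omega) i (by omega),
        dual_psiK_two_apply m (by omega) i (by omega), if_neg (by omega), if_neg (by omega), sub_zero]
  · have hk2 : 2 ≤ (k : ℕ) := by omega
    have hkm : (k : ℕ) + 1 ≤ m := k.2
    refine ⟨(psiK m ((k : ℕ) + 1)).dual,
      mem_closure_chowOccWeights_of_isRealized hm0 (isRealized_genK ℂ m (by omega) hkm), ?_, ?_⟩
    · rw [dual_psiK_apply_of_two_le m hkm k hk2, if_pos (Nat.lt_succ_self _)]
    · intro i hi
      have := Fin.lt_def.mp hi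
      rw [dual_psiK_apply_of_two_le m hkm i (by omega), if_neg (by omega)]

/-- **BHI Prop. 3, proved**: "`S(Chow_n)` generates the group `{λ ∈ ℤ^n | ∑ λ_i ≡ 0 mod n}` if
`n > 2`" — discharge of the named fact `BHI2017_prop3` through
`BHI2017_prop3_of_generators`. [cite: BurgisserHuttenhainIkenmeyer2017, Prop. 3] -/
theorem BHI2017_prop3_holds : BHI2017_prop3 :=
  BHI2017_prop3_of_generators fun _ hm k hk => chow_generators hm k hk

/-! ### The cone (the half of Prop. 2 used in Theorem 3) -/

/-- **Every polynomial weight of `GL_m` has a positive multiple in `S(Chow_m)`** (`m ≥ 1`): `2m·χ`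
is realised in `𝒪(V^m // H_m)` by products of the cone generators (`isRealized_conePsi`), and a
power of the realising vector lands in `𝒪(Chow_m)` by Brion's theorem. This is the inclusion
"`{λ : ℓ(λ) ≤ n, n ∣ |λ|} ⊆` rational cone of `S(Chow_n)`" of BHI Prop. 2 (there with the bound
`2N`, `N < n^{n²-2n}`, which Theorem 3 does not use). [cite: BurgisserHuttenhainIkenmeyer2017, Prop. 2 (first assertion)] -/
theorem exists_nsmul_mem_chowOccWeights (hm : 0 < m) {χ : Weight (Fin m)} (hχ : χ.IsPolynomial) :
    ∃ K : ℕ, 0 < K ∧ K • χ ∈ chowOccWeights m := by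
  haveI : NeZero m := ⟨hm.ne'⟩
  by_cases h0 : χ = 0
  · exact ⟨1, Nat.one_pos, by rw [h0, smul_zero]; exact zero_mem _⟩
  · obtain ⟨t, ht, hmem⟩ := nsmul_mem_chowOccWeights_of_isRealized hm (isRealized_conePsi ℂ m χ)
      (coneDeg_pos m hχ h0)
    refine ⟨t * (2 * m), Nat.mul_pos ht (by omega), ?_⟩
    rw [mul_smul]
    rwa [dual_conePsi m hχ] at hmem

/-! ### Theorem 3, Theorem 1, and the barrier -/

/-- **BHI Theorem 3, proved**: "`Sat(S(Chow_n)) = {λ ∈ Λ⁺_{Gl_n}(poly) | |λ| ≡ 0 mod n}`, provided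
`n > 2`" — discharge of the named fact `BHI2017_thm3`: `⊆` by `isPolynomial_of_mem_chowOccWeights`
and `A(S(Chow_n)) ⊆ L`; `⊇` by Prop. 3 (`BHI2017_prop3_holds`) for the group and the cone
(`exists_nsmul_mem_chowOccWeights`). [cite: BurgisserHuttenhainIkenmeyer2017, Thm. 3] -/
theorem BHI2017_thm3_holds : BHI2017_thm3 := by
  intro m hm
  ext χ
  rw [mem_saturation_iff, Set.mem_setOf_eq]
  constructor
  · rintro ⟨hA, k, hk, hkχ⟩
    exact ⟨(isPolynomial_of_mem_chowOccWeights hkχ).of_nsmul hk,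
      (mem_bhiLattice_iff m χ).mp (closure_chowOccWeights_le_bhiLattice m hA)⟩
  · rintro ⟨hpoly, hsize⟩
    refine ⟨?_, exists_nsmul_mem_chowOccWeights (by omega) hpoly⟩
    rw [BHI2017_prop3_holds m hm, mem_bhiLattice_iff]
    exact hsize

/-- **BHI Theorem 1, proved** (discharge of the named fact `BHI2017_thm1`), from Theorem 3 and
`S(Chow_n) ⊆ S(Det_n)` (`BHI2017_thm1_of_thm3`). [cite: BurgisserHuttenhainIkenmeyer2017, Thm. 1] -/
theorem BHI2017_thm1_holds : BHI2017_thm1 :=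
  BHI2017_thm1_of_thm3 BHI2017_thm3_holds

/-- **The barrier "not via saturations", proved**: discharge of the named fact `NotViaSaturations`
(= `BHI2017_thm1`: every partition `λ ⊢ nd` with `ℓ(λ) ≤ n`, `n > 2`, lies in `Sat(S(Det_n))` — the
saturation of the monoid of representations of the orbit closure of the determinant has no holes
beyond the divisibility and length conditions, so occurrence obstructions cannot be found through
saturations). [cite: BurgisserHuttenhainIkenmeyer2017, Thm. 1] -/
theorem NotViaSaturations_holds : NotViaSaturations :=
  notViaSaturations_of_thm3 BHI2017_thm3_holds

/-- **BHI Prop. 2 (the rational cone), proved**: discharge of the named fact `BHI2017_prop2`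
("`S(Chow_n)` generates the rational cone `{q ∈ ℚ^n | q_1 ≥ ⋯ ≥ q_n ≥ 0}`", in the lattice form
`C_ℚ(S(Chow_m)) ∩ ℤ^m = Λ⁺_{GL_m}(poly)`): `⊆` because a weight with a positive multiple in
`S(Chow_m) ⊆ Λ⁺(poly)` is polynomial (`isPolynomial_of_mem_chowOccWeights`,
`IsPolynomial.of_nsmul`), `⊇` by `exists_nsmul_mem_chowOccWeights` (cone generators and Brion's
theorem).
[cite: BurgisserHuttenhainIkenmeyer2017, Prop. 2 (first assertion)] -/
theorem BHI2017_prop2_holds : BHI2017_prop2 := by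
  intro m hm
  ext χ
  exact ⟨fun ⟨k, hk, hkχ⟩ => (isPolynomial_of_mem_chowOccWeights hkχ).of_nsmul hk,
    fun hχ => exists_nsmul_mem_chowOccWeights hm hχ⟩

end Literature.Barriers.ValiantsHypothesis
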